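import Literature.NumberTheory.Automorphic.ShimuraCurveRibetTakahashiDenominatorAwayFromS
import Literature.NumberTheory.Automorphic.ShimuraCurveRibetTakahashiNumeratorProofs
import Literature.NumberTheory.Automorphic.ShimuraCurveDataExistence
import Literature.NumberTheory.Automorphic.ShimuraCurveRibetTakahashiCokernelProofs
import Literature.NumberTheory.Automorphic.ShimuraParametrizationSplitDegreeProofs
import Literature.NumberTheory.EllipticCurves.PastenHeightBoundsLemma68LocalProofs
import HarnessLib

/-!
# Pasten 2024, Thm. 6.1 (a) (denominator of `γ_{D,M,E}` for curves semi-stable away from `S`):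
# the printed telescoping of §6.9 with the ordering `rᵢ < pᵢ`, performed in the tree

Topic `NumberTheory/Automorphic`; a proofs-only companion (theorems only: no definition, no named
fact, nothing restated; D-0026) of `ShimuraCurveRibetTakahashiDenominatorAwayFromS.lean`, for its
named fact `Literature.NumberTheory.Automorphic.PastenShimura2024_thm_6_1_a` (H. Pasten, *Shimura
curves and the abc conjecture*, J. Number Theory 254 (2024) = arXiv:1705.09251v4, Thm. 6.1 (a)
p. 20: for `S` finite there is `κ_S ≥ 1` supported on primes `≤ 163` such that, for `E` semi-stable
away from `S`, the denominator of `γ_{D,M,E}` is `≤ κ_S^{ω(D)} · D`). It is the item-(a) twin of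
`ShimuraCurveRibetTakahashiDenominatorProofs.lean` (item (b)), whose induction it copies with the
one change the source prescribes (§6.9 p. 25, held arXiv text, read):

> *"The result of item (a) regarding the denominator of `γ_{D,M,E}` follows in a similar fashion.
> Here one also uses Lemma 6.14 on the factors `i_p(d,prm)²` occurring in the various applications
> of (EqSequentially), and Lemma 6.18 on the factors `j_r(dpr,m)²`. For this we choose a prime
> factorization `D = p₁r₁⋯pₙrₙ` in some order satisfying `rᵢ < pᵢ` for each `i`. Then we
> sequentially apply (EqSequentially) and the previous estimates to the pairs of factors `(pᵢ,rᵢ)`.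
> By Lemma 6.18, the total contribution of the cokernel factors to the denominator of `γ_{D,M,E}` is
> bounded by `r₁²⋯rₙ² < p₁r₁⋯pₙrₙ = D` since we chose `rᵢ < pᵢ`."*

Lemma 6.18 (p. 25): "Let `p` be a prime with `p ∣ D`. Then `j_p(D,M)` divides `p − 1` if `p` is
odd, and it divides `2` if `p = 2`. In particular, `j_p(D,M) ≤ p`" (Papikian–Rabinoff, Cor. 3.5).
Lemma 6.14 (p. 23): for `N = DM` squarefree away from `S` and `p ∥ M`, `i_p(D,M) ∣ κ_S`.
Lemma 6.8 (p. 22): `c_p(A)/c_p(B)` has height `≤ 163` for `ℚ`-isogenous `A, B` multiplicative at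
`p`; `c_p(E) = v_p(Δ_E)` (§6.4 p. 22).

What this file proves (sorry-free, no new named fact, no statement of the tree changed):

* `PastenShimura2024_thm_6_1_a_of_eqSequentially` — **Thm. 6.1 (a) from the two-prime step with
  denominator `≤ κ₀ · r²`, exactly as printed**: induction on `n = ω(D)/2` removing at each step the
  LARGEST prime `p` of `D` together with any other prime `r` of `D` (so `r < p` and `r² ≤ p r`);
  inputs (`hstep`) (EqSequentially) with Lemmas 6.8, 6.14, 6.18 folded in — for `E` semi-stable away
  from `S`, `δ_{d,prM} · b = a · δ_{D,M} · v_p(Δ_E) v_r(Δ_E)` with `a, b ≥ 1`, `b ≤ κ₀ r²`, one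
  `κ₀ = κ₀(S) ≥ 1` supported on primes `≤ 163` —, (`h0`) the case `D = 1` (the class-minimal degree
  of Shimura data on an `X : ShimuraCurveData 1 N` divides `δ_{1,N}`: Pasten's `J₀^1(N) = J₀(N)`,
  §2 p. 12; the fact gives it back, `deg_dvd_of_PastenShimura2024_thm_6_1_a`), the tree's
  Jacquet–Langlands fact `nonempty_shimuraParametrizationData` (data at the intermediate levels) and
  the THEOREM `nonempty_shimuraCurveData_holds` (the curves `X₀^d(prM)`); output: the fact with
  `κ_S = κ₀(S)` (`b ≤ κ₀^{ω(d)} d · κ₀ r² ≤ κ₀^{ω(D)} D`);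
* `eqSequentially_a_of_prop_6_13_general_of_lemma_6_8` — the two-prime step from **Prop. 6.13 with
  Lemma 6.14 and Lemma 6.18** (`h613a`: Ribet–Takahashi's identity
  `δ_{d,prM} · i² j² = δ_{D,M} · c_p(A_{d,prM}) c_r(A_{D,M})` with `i = i_p(d,prM) ∣ κ₁` and
  `j = j_r(D,M) ≤ r` for `E` semi-stable away from `S` — the tree has no component groups, so
  `i, j` are existential and their bounds travel with them) and **Lemma 6.8** (`h68`, verbatim the
  hypothesis of the (b) sibling): then `b = i² j² b₁ b₂ ≤ κ₁² (163!)² · r²` and `a = a₁ a₂`;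
* `PastenShimura2024_thm_6_1_a_of_prop_6_13_general_of_lemma_6_8` — the two glued, with
  `κ_S = κ₁(S)² (163!)²`. So the open content of `PastenShimura2024_thm_6_1_a_holds` beyond its own
  `D = 1` instance is exactly: Prop. 6.13 (= Ribet–Takahashi 1997 Thm. 2) with Lemma 6.14 (Ribet's
  Eisenstein property; Lemmas 6.5–6.7) and Lemma 6.18 (Papikian–Rabinoff), and Lemma 6.8
  (Mazur–Kenku; the tree's `PastenShimura2024_lemma_6_8` / `mazurKenku_exists_cyclic_isogeny` in
  factorisation form) — no Diophantine input (Thm. 6.17's Lemmas 6.9–6.12 are not used by (a));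
* `twoPrimeStep_a_of_ribetTakahashi_inputs`, `PastenShimura2024_thm_6_1_a_of_ribetTakahashi_inputs`
  (second instalment) — the same over the "Ribet–Takahashi system" binders of
  `ShimuraCurveRibetTakahashiCokernelProofs.lean` (the orders `i_p`, `j_p` as functions `cI`, `cJ`
  of the class-minimal datum; Prop. 6.13 `h613`, Lemma 6.14 `h614` per `S`, Lemma 6.8 `h68`) plus
  Lemma 6.18 as `h618 : cJ P p ≤ p` for `p ∣ D` — the (a)-twin of
  `PastenShimura2024_thm_6_1_b_of_ribetTakahashi_inputs`;
* `PastenShimura2024_thm_6_1_a_of_ribetTakahashi_eisenstein_mazurKenku` (third instalment) — the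
  same with Lemma 6.8 from the named fact `mazurKenku_exists_cyclic_isogeny`, Lemma 6.14 from the
  Eisenstein property `hEis` and Lemma 6.7 `h67` (the tree's `PastenShimura2024_lemma_6_14`) and the
  `D = 1` bridge a THEOREM (`IsMinimalFor.deg_dvd_modularDegree`): the open content of the fact is
  exactly Prop. 6.13, Ribet's Eisenstein property, Lemma 6.7, Lemma 6.18, Mazur–Kenku and
  Jacquet–Langlands — the (a)-twin of `PastenShimura2024_thm_6_1_b_of_ribetTakahashi_eisenstein_mazurKenku`
  minus every Diophantine input.

## References

* H. Pasten, *Shimura curves and the abc conjecture*, J. Number Theory 254 (2024) 214–335 =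
  arXiv:1705.09251v4: §2 p. 12, Thm. 6.1 (a) p. 20, §6.4 and Lemma 6.8 p. 22, Prop. 6.13 and
  Lemma 6.14 p. 23, Lemma 6.18 and §6.9 p. 25 (held arXiv text, read). [PastenShimura2024]
* K. A. Ribet, S. Takahashi, PNAS 94 (1997) 11110–11114, Thm. 2. [RibetTakahashi1997]
-/

noncomputable section

open scoped MatrixGroups

namespace Literature.NumberTheory.Automorphic

open Literature.NumberTheory.EllipticCurves.ModularForms (ModularParametrizationData IsNewformOf)

/-! ### Thm. 6.1 (a) from the two-prime step: the telescoping of §6.9 with `rᵢ < pᵢ` -/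

/-- **Pasten 2024, Thm. 6.1 (a) from (EqSequentially) with Lemmas 6.14 and 6.18 — the printed
proof** (§6.9 p. 25: "we choose a prime factorization `D = p₁r₁⋯pₙrₙ` in some order satisfying
`rᵢ < pᵢ` … the total contribution of the cokernel factors to the denominator … is bounded by
`r₁²⋯rₙ² < p₁r₁⋯pₙrₙ = D`"). Inputs:

* (`hstep`) **the two-prime step with denominator `≤ κ₀ r²`**, in the tree's idiom: for `N = DM`
  admissible, `D = d · pr` with primes `r < p`, `E` rendered as a globally minimal `W` of conductor
  `N`, semi-stable away from `S` (`q² ∤ N` for primes `q ∉ S`), a datum `P₁` realising `δ_{d,prM}`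
  and a datum `P₂` realising `δ_{D,M}`: `δ_{d,prM} · b = a · δ_{D,M} · v_p(Δ_E) v_r(Δ_E)` for some
  `a, b ≥ 1` with `b ≤ κ₀ · r²` (`κ₀ ≥ 1` depending on `S` only) — i.e. (EqSequentially) with the
  denominator of `u_{d,p,r,m}` bounded by Lemma 6.8, `i_p(d,prM) ∣ κ_S` by Lemma 6.14 and
  `j_r(D,M) ≤ r` by Lemma 6.18;
* (`h0`) **the case `D = 1`** (`J₀^1(N) = J₀(N)`, §2 p. 12): the class-minimal degree of Shimura
  data on any `X : ShimuraCurveData 1 N` divides `δ_{1,N} = D₁.modularDegree` (for every elliptic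
  `W`; the fact gives it back, `deg_dvd_of_PastenShimura2024_thm_6_1_a`);
* (`hP`) the tree's named fact `nonempty_shimuraParametrizationData`; the curves `X₀^d(prM)` come
  from the THEOREM `nonempty_shimuraCurveData_holds`.

Proof: induction on `n = ω(D)/2` for fixed `N, W, D₁`; at each step `p` is the largest prime of
`D` and `r` another one, so `r < p`; denominators multiply,
`b = b₁ b₂ ≤ (κ₀^{ω(d)} d)(κ₀ r²) ≤ κ₀^{ω(D)} · d p r = κ₀^{ω(D)} D`.
[cite: PastenShimura2024, Thm. 6.1 (a) p. 20 and its proof §6.9 p. 25, with Lemma 6.14 p. 23 and Lemma 6.18 p. 25] -/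
theorem PastenShimura2024_thm_6_1_a_of_eqSequentially
    (hP : nonempty_shimuraParametrizationData)
    (h0 : ∀ {N : ℕ} [NeZero N] (X : ShimuraCurveData 1 N) (W : WeierstrassCurve ℚ) [W.IsElliptic]
      [W.IsGloballyMinimal], W.conductorNorm ℤ = N →
      ∀ (W₁ : WeierstrassCurve ℚ) [W₁.IsElliptic] (D₁ : ModularParametrizationData W₁ N),
        IsNewformOf W D₁.f →
        (∀ (W₂ : WeierstrassCurve ℚ) [W₂.IsElliptic] (D₂ : ModularParametrizationData W₂ N),
            D₂.f = D₁.f → D₁.modularDegree ≤ D₂.modularDegree) →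
      ∀ (W' : WeierstrassCurve ℚ) [W'.IsElliptic] (P : ShimuraParametrizationData X W'),
        P.IsMinimalFor W → P.deg ∣ D₁.modularDegree)
    (hstep : ∀ S : Finset ℕ, ∃ κ₀ : ℕ, 1 ≤ κ₀ ∧ (∀ q ∈ κ₀.primeFactors, q ≤ 163) ∧
      ∀ {N D M d p r : ℕ}, p.Prime → r.Prime → r < p → D = d * (p * r) →
      IsAdmissibleFactorization N D M →
      ∀ (X₁ : ShimuraCurveData d (p * r * M)) (X₂ : ShimuraCurveData D M)
        (W : WeierstrassCurve ℚ) [W.IsElliptic] [W.IsGloballyMinimal], W.conductorNorm ℤ = N →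
        (∀ q : ℕ, q.Prime → q ∉ S → ¬ q ^ 2 ∣ N) →
      ∀ (W₁' : WeierstrassCurve ℚ) [W₁'.IsElliptic] (P₁ : ShimuraParametrizationData X₁ W₁'),
        P₁.IsMinimalFor W →
      ∀ (W₂' : WeierstrassCurve ℚ) [W₂'.IsElliptic] (P₂ : ShimuraParametrizationData X₂ W₂'),
        P₂.IsMinimalFor W →
        ∃ a b : ℕ, 0 < a ∧ 0 < b ∧ b ≤ κ₀ * r ^ 2 ∧
          P₁.deg * b = a * P₂.deg *
            ((W.minimalDiscriminantNorm ℤ).factorization p *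
              (W.minimalDiscriminantNorm ℤ).factorization r)) :
    PastenShimura2024_thm_6_1_a := by
  intro S
  obtain ⟨κ₀, hκ₀, hκ₀', hstep⟩ := hstep S
  refine ⟨κ₀, hκ₀, hκ₀', ?_⟩
  intro N D M _ hadm X W _ _ hWN hS W₁ _ D₁ hf hmin W' _ P hPmin
  -- the printed induction on `n = ω(D)/2`, for fixed `N`, `W` (= `E`) and `δ_{1,N}` (= `D₁`)
  obtain ⟨n, hn⟩ := hadm.even_card_primeFactors
  induction n generalizing D M W' with
  | zero =>
    -- `D = 1`, `M = N`: `deg P ∣ δ_{1,N}` (`h0`), take `b = 1`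
    have hD : D = 1 := by
      have h1 := Nat.primeFactors_eq_empty.mp (Finset.card_eq_zero.mp hn)
      exact h1.resolve_left hadm.squarefree.ne_zero
    subst hD
    obtain rfl : M = N := by simpa using hadm.mul_eq
    obtain ⟨a, ha⟩ := h0 X W hWN W₁ D₁ hf hmin W' P hPmin
    refine ⟨a, 1, Nat.pos_of_ne_zero ?_, Nat.one_pos, by simp, ?_⟩
    · rintro rfl
      exact D₁.deg_pos.ne' (by simpa [ModularParametrizationData.modularDegree] using ha)
    · simp [ha, mul_comm]
  | succ n ih =>
    -- the LARGEST prime `p` of `D` and another prime `r < p`, `d = D/(pr)`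
    have hne : D.primeFactors.Nonempty := Finset.card_pos.mp (by omega)
    set p := D.primeFactors.max' hne with hpdef
    have hp : p ∈ D.primeFactors := Finset.max'_mem _ _
    obtain ⟨r, hr⟩ : (D.primeFactors.erase p).Nonempty :=
      Finset.card_pos.mp (by rw [Finset.card_erase_of_mem hp]; omega)
    obtain ⟨hrp, hr⟩ := Finset.mem_erase.mp hr
    have hrltp : r < p := lt_of_le_of_ne (Finset.le_max' _ r hr) hrp
    have hpp : p.Prime := Nat.prime_of_mem_primeFactors hp
    have hrr : r.Prime := Nat.prime_of_mem_primeFactors hr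
    obtain ⟨hDd, hadm₁, hdisj, hpf⟩ :=
      hadm.erase_two_primes hpp hrr (Ne.symm hrp) (Nat.dvd_of_mem_primeFactors hp)
        (Nat.dvd_of_mem_primeFactors hr)
    set d := D / (p * r) with hd
    have hcard : D.primeFactors.card = d.primeFactors.card + 2 := by
      rw [hpf, Finset.card_union_of_disjoint hdisj, Finset.card_pair (Ne.symm hrp)]
    -- the curve `X₀^d(prM)` and a datum realising `δ_{d,prM}`
    obtain ⟨X₁⟩ := nonempty_shimuraCurveData_holds hadm₁
    obtain ⟨W₁', hW₁', P₁, hP₁min⟩ :=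
      ShimuraParametrizationData.exists_isMinimalFor_of_nonempty (hP hadm₁ X₁ W hWN)
    -- induction hypothesis at level `(d, prM)` and the two-prime step
    obtain ⟨a₁, b₁, ha₁, hb₁, hb₁d, h₁⟩ := ih hadm₁ X₁ W₁' P₁ hP₁min (by omega)
    obtain ⟨a₂, b₂, ha₂, hb₂, hb₂d, h₂⟩ :=
      hstep hpp hrr hrltp hDd hadm X₁ X W hWN hS W₁' P₁ hP₁min W' P hPmin
    refine ⟨a₁ * a₂, b₁ * b₂, Nat.mul_pos ha₁ ha₂, Nat.mul_pos hb₁ hb₂, ?_, ?_⟩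
    · -- `b₁ b₂ ≤ (κ₀^{ω(d)} d)(κ₀ r²) ≤ κ₀^{ω(d)+2} (d p r) = κ₀^{ω(D)} D`
      have hr2 : r ^ 2 ≤ p * r := by rw [sq]; exact Nat.mul_le_mul_right r hrltp.le
      have hκpow : κ₀ ^ d.primeFactors.card * κ₀ ≤ κ₀ ^ (d.primeFactors.card + 2) := by
        rw [pow_add, sq]
        exact Nat.mul_le_mul_left _ (Nat.le_mul_of_pos_right κ₀ hκ₀)
      calc b₁ * b₂ ≤ (κ₀ ^ d.primeFactors.card * d) * (κ₀ * r ^ 2) := Nat.mul_le_mul hb₁d hb₂d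
        _ = (κ₀ ^ d.primeFactors.card * κ₀) * (d * r ^ 2) := by ring
        _ ≤ κ₀ ^ (d.primeFactors.card + 2) * (d * (p * r)) :=
            Nat.mul_le_mul hκpow (Nat.mul_le_mul_left d hr2)
        _ = κ₀ ^ D.primeFactors.card * D := by rw [hcard, ← hDd]
    · rw [hpf, Finset.prod_union hdisj, Finset.prod_pair (Ne.symm hrp)]
      set V := ∏ q ∈ d.primeFactors, (W.minimalDiscriminantNorm ℤ).factorization q
      set vp := (W.minimalDiscriminantNorm ℤ).factorization p
      set vr := (W.minimalDiscriminantNorm ℤ).factorization r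
      calc D₁.modularDegree * (b₁ * b₂) = D₁.modularDegree * b₁ * b₂ := by ring
        _ = a₁ * P₁.deg * V * b₂ := by rw [h₁]
        _ = a₁ * V * (P₁.deg * b₂) := by ring
        _ = a₁ * V * (a₂ * P.deg * (vp * vr)) := by rw [h₂]
        _ = a₁ * a₂ * P.deg * (V * (vp * vr)) := by ring

/-! ### Conversely: the fact gives back its `D = 1` instance `h0` -/

/-- **The fact implies its `D = 1` input** (so the hypothesis `h0` of
`PastenShimura2024_thm_6_1_a_of_eqSequentially` asks for nothing beyond the fact): at the admissible
factorisation `N = 1 · N`, with `S` := the primes whose square divides `N` (so that `W` is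
semi-stable away from `S` tautologically), the fact gives `δ_{1,N} · b = a · deg P` with
`b ≤ κ⁰ · 1 = 1`, i.e. `deg P ∣ δ_{1,N}` for every class-minimal Shimura datum `P` on a curve
`X : ShimuraCurveData 1 N` and every elliptic `W` of conductor `N` (Pasten: `J₀^1(N) = J₀(N)`, §2
p. 12). [cite: PastenShimura2024, Thm. 6.1 (a) p. 20 (case D = 1) with §2 p. 12] -/
theorem deg_dvd_of_PastenShimura2024_thm_6_1_a (h : PastenShimura2024_thm_6_1_a) {N : ℕ}
    [NeZero N] (X : ShimuraCurveData 1 N) (W : WeierstrassCurve ℚ) [W.IsElliptic]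
    [W.IsGloballyMinimal] (hWN : W.conductorNorm ℤ = N)
    (W₁ : WeierstrassCurve ℚ) [W₁.IsElliptic] (D₁ : ModularParametrizationData W₁ N)
    (hf : IsNewformOf W D₁.f)
    (hmin : ∀ (W₂ : WeierstrassCurve ℚ) [W₂.IsElliptic] (D₂ : ModularParametrizationData W₂ N),
      D₂.f = D₁.f → D₁.modularDegree ≤ D₂.modularDegree)
    (W' : WeierstrassCurve ℚ) [W'.IsElliptic] (P : ShimuraParametrizationData X W')
    (hP : P.IsMinimalFor W) : P.deg ∣ D₁.modularDegree := by
  obtain ⟨κ, -, -, h⟩ := h N.primeFactors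
  have hS : ∀ q : ℕ, q.Prime → q ∉ N.primeFactors → ¬ q ^ 2 ∣ N := fun q hq hqS h2 =>
    hqS (Nat.mem_primeFactors.mpr ⟨hq, (dvd_pow_self q two_ne_zero).trans h2, NeZero.ne N⟩)
  obtain ⟨a, b, -, hb, hble, hab⟩ :=
    h (isAdmissibleFactorization_one (NeZero.pos N)) X W hWN hS W₁ D₁ hf hmin W' P hP
  have hb1 : b = 1 := by
    have : b ≤ 1 := by simpa using hble
    omega
  subst hb1
  exact ⟨a, by simpa [mul_comm] using hab⟩

/-! ### The two-prime step from Prop. 6.13, Lemma 6.14, Lemma 6.18 and Lemma 6.8 -/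

/-- **(EqSequentially) for part (a) — the two-prime step with denominator `≤ κ₁² (163!)² · r²`,
from Prop. 6.13 with Lemma 6.14 and Lemma 6.18, and Lemma 6.8** (§6.9 p. 25: "Here one also uses
Lemma 6.14 on the factors `i_p(d,prm)²` … and Lemma 6.18 on the factors `j_r(dpr,m)²`"). Inputs, as
explicit hypotheses because they are not declarations of the tree:

* (`h613a`) **Prop. 6.13 = Ribet–Takahashi 1997, Thm. 2, with the bounds of Lemma 6.14 and
  Lemma 6.18 attached** (p. 23: "`δ_{d,prM}/δ_{dpr,M} = c_p(A_{d,prM}) · c_r(A_{dpr,M}) /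
  (i_p(d,prM)² · j_r(dpr,M)²)`"; Lemma 6.14: `i_p(d,prM) ∣ κ_S` for `N` squarefree away from `S`,
  `p ∥ prM`; Lemma 6.18: `j_r(dpr,M) ≤ r`), in the tree's idiom: `A_{d,prM}`, `A_{D,M}` are the
  curves `W₁'`, `W₂'` of data realising `δ_{d,prM}`, `δ_{D,M}` (`IsMinimalFor`), `c_p(A) = v_p` of
  the minimal discriminant, and `i, j` are existential positive integers carrying their bounds
  `i ∣ κ₁` (`κ₁ = κ_S` of Lemma 6.14), `j ≤ r`, for `E` semi-stable away from `S`;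
* (`h68`) **Lemma 6.8**, verbatim the hypothesis of the (b) sibling's
  `eqSequentially_b_of_prop_6_13_bounded_of_lemma_6_8`: `W ∼ W'`, `p ∥ N_W` ⇒
  `c_p(W') · b = a · c_p(W)`, `1 ≤ a, b ≤ 163`.

Proof (as printed): `δ_{d,prM} i² j² = δ_{D,M} c_p(A₁) c_r(A₂)`, `c_p(A₁) b₁ = a₁ c_p(E)`,
`c_r(A₂) b₂ = a₂ c_r(E)` give `δ_{d,prM} · (i² j² b₁ b₂) = (a₁a₂) · δ_{D,M} · c_p(E) c_r(E)`, and
`i² j² b₁ b₂ ≤ κ₁² r² (163!)²` (`b₁, b₂ ≤ 163` divide `163!`); `p, r ∣ D` divide `N` exactly once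
(`IsAdmissibleFactorization.dvd_and_not_sq_dvd`).
[cite: PastenShimura2024, §6.9 p. 25 ((EqSequentially), item (a)), Prop. 6.13 and Lemma 6.14 p. 23, Lemma 6.18 p. 25, Lemma 6.8 p. 22] -/
theorem eqSequentially_a_of_prop_6_13_general_of_lemma_6_8 {S : Finset ℕ} {κ₁ : ℕ} (hκ₁ : 1 ≤ κ₁)
    (h613a : ∀ {N D M d p r : ℕ}, p.Prime → r.Prime → p ≠ r → D = d * (p * r) →
      IsAdmissibleFactorization N D M →
      ∀ (X₁ : ShimuraCurveData d (p * r * M)) (X₂ : ShimuraCurveData D M)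
        (W : WeierstrassCurve ℚ) [W.IsElliptic] [W.IsGloballyMinimal], W.conductorNorm ℤ = N →
        (∀ q : ℕ, q.Prime → q ∉ S → ¬ q ^ 2 ∣ N) →
      ∀ (W₁' : WeierstrassCurve ℚ) [W₁'.IsElliptic] (P₁ : ShimuraParametrizationData X₁ W₁'),
        P₁.IsMinimalFor W →
      ∀ (W₂' : WeierstrassCurve ℚ) [W₂'.IsElliptic] (P₂ : ShimuraParametrizationData X₂ W₂'),
        P₂.IsMinimalFor W →
        ∃ i j : ℕ, 0 < i ∧ 0 < j ∧ i ∣ κ₁ ∧ j ≤ r ∧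
          P₁.deg * (i ^ 2 * j ^ 2) = P₂.deg *
            ((W₁'.minimalDiscriminantNorm ℤ).factorization p *
              (W₂'.minimalDiscriminantNorm ℤ).factorization r))
    (h68 : ∀ (W W' : WeierstrassCurve ℚ) [W.IsElliptic] [W'.IsElliptic], W.IsIsogenous W' →
      ∀ p : ℕ, p.Prime → p ∣ W.conductorNorm ℤ → ¬ p ^ 2 ∣ W.conductorNorm ℤ →
        ∃ a b : ℕ, 0 < a ∧ a ≤ 163 ∧ 0 < b ∧ b ≤ 163 ∧
          (W'.minimalDiscriminantNorm ℤ).factorization p * b =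
            a * (W.minimalDiscriminantNorm ℤ).factorization p)
    {N D M d p r : ℕ} (hp : p.Prime) (hr : r.Prime) (hrp : r < p) (hD : D = d * (p * r))
    (hadm : IsAdmissibleFactorization N D M)
    (X₁ : ShimuraCurveData d (p * r * M)) (X₂ : ShimuraCurveData D M)
    (W : WeierstrassCurve ℚ) [W.IsElliptic] [W.IsGloballyMinimal] (hWN : W.conductorNorm ℤ = N)
    (hS : ∀ q : ℕ, q.Prime → q ∉ S → ¬ q ^ 2 ∣ N)
    (W₁' : WeierstrassCurve ℚ) [W₁'.IsElliptic] (P₁ : ShimuraParametrizationData X₁ W₁')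
    (hP₁ : P₁.IsMinimalFor W)
    (W₂' : WeierstrassCurve ℚ) [W₂'.IsElliptic] (P₂ : ShimuraParametrizationData X₂ W₂')
    (hP₂ : P₂.IsMinimalFor W) :
    ∃ a b : ℕ, 0 < a ∧ 0 < b ∧ b ≤ κ₁ ^ 2 * (Nat.factorial 163) ^ 2 * r ^ 2 ∧
      P₁.deg * b = a * P₂.deg *
        ((W.minimalDiscriminantNorm ℤ).factorization p *
          (W.minimalDiscriminantNorm ℤ).factorization r) := by
  -- `p, r ∣ D` are multiplicative for `E`: `p ∥ N`, `r ∥ N`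
  have hpD : p ∣ D := ⟨d * r, by rw [hD]; ring⟩
  have hrD : r ∣ D := ⟨d * p, by rw [hD]; ring⟩
  obtain ⟨hpN, hp2N⟩ := hadm.dvd_and_not_sq_dvd hp hpD
  obtain ⟨hrN, hr2N⟩ := hadm.dvd_and_not_sq_dvd hr hrD
  rw [← hWN] at hpN hp2N hrN hr2N
  -- Prop. 6.13 with Lemma 6.14 / Lemma 6.18, and Lemma 6.8 (twice)
  obtain ⟨i, j, hi, hj, hiκ, hjr, h13⟩ :=
    h613a hp hr (Nat.ne_of_gt hrp) hD hadm X₁ X₂ W hWN hS W₁' P₁ hP₁ W₂' P₂ hP₂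
  obtain ⟨a₁, b₁, ha₁, -, hb₁, hb₁le, h₁⟩ := h68 W W₁' hP₁.1 p hp hpN hp2N
  obtain ⟨a₂, b₂, ha₂, -, hb₂, hb₂le, h₂⟩ := h68 W W₂' hP₂.1 r hr hrN hr2N
  refine ⟨a₁ * a₂, i ^ 2 * j ^ 2 * (b₁ * b₂), Nat.mul_pos ha₁ ha₂,
    Nat.mul_pos (Nat.mul_pos (pow_pos hi 2) (pow_pos hj 2)) (Nat.mul_pos hb₁ hb₂), ?_, ?_⟩
  · -- `i² j² b₁ b₂ ≤ κ₁² r² (163!)²`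
    have hiκ' : i ≤ κ₁ := Nat.le_of_dvd (by omega) hiκ
    have hb₁f : b₁ ≤ Nat.factorial 163 := Nat.le_of_dvd (Nat.factorial_pos _) (Nat.dvd_factorial hb₁ hb₁le)
    have hb₂f : b₂ ≤ Nat.factorial 163 := Nat.le_of_dvd (Nat.factorial_pos _) (Nat.dvd_factorial hb₂ hb₂le)
    calc i ^ 2 * j ^ 2 * (b₁ * b₂)
        ≤ κ₁ ^ 2 * r ^ 2 * (Nat.factorial 163 * Nat.factorial 163) :=
          Nat.mul_le_mul (Nat.mul_le_mul (Nat.pow_le_pow_left hiκ' 2) (Nat.pow_le_pow_left hjr 2))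
            (Nat.mul_le_mul hb₁f hb₂f)
      _ = κ₁ ^ 2 * (Nat.factorial 163) ^ 2 * r ^ 2 := by ring
  · set c₁ := (W₁'.minimalDiscriminantNorm ℤ).factorization p
    set c₂ := (W₂'.minimalDiscriminantNorm ℤ).factorization r
    set vp := (W.minimalDiscriminantNorm ℤ).factorization p
    set vr := (W.minimalDiscriminantNorm ℤ).factorization r
    calc P₁.deg * (i ^ 2 * j ^ 2 * (b₁ * b₂)) = P₁.deg * (i ^ 2 * j ^ 2) * (b₁ * b₂) := by ring
      _ = P₂.deg * (c₁ * c₂) * (b₁ * b₂) := by rw [h13]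
      _ = P₂.deg * ((c₁ * b₁) * (c₂ * b₂)) := by ring
      _ = P₂.deg * ((a₁ * vp) * (a₂ * vr)) := by rw [h₁, h₂]
      _ = a₁ * a₂ * P₂.deg * (vp * vr) := by ring

/-- The constant `κ_S = κ₁² (163!)²` is `≥ 1` and supported on primes `≤ 163` when `κ₁` is
(Thm. 6.1 (a): "a positive integer `κ_S` … supported on primes `≤ 163`").
[cite: PastenShimura2024, Thm. 6.1 (a) p. 20] -/
theorem primeFactors_le_of_kappa_a {κ₁ : ℕ} (hκ₁ : 1 ≤ κ₁) (hκ₁' : ∀ p ∈ κ₁.primeFactors, p ≤ 163) :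
    1 ≤ κ₁ ^ 2 * (Nat.factorial 163) ^ 2 ∧
      ∀ p ∈ (κ₁ ^ 2 * (Nat.factorial 163) ^ 2).primeFactors, p ≤ 163 := by
  refine ⟨Nat.one_le_iff_ne_zero.mpr (mul_ne_zero (pow_ne_zero 2 (by omega))
    (pow_ne_zero 2 (Nat.factorial_pos 163).ne')), fun p hp => ?_⟩
  have hp' := Nat.prime_of_mem_primeFactors hp
  rcases (Nat.Prime.dvd_mul hp').mp (Nat.dvd_of_mem_primeFactors hp) with h | h
  · exact hκ₁' p (Nat.mem_primeFactors.mpr ⟨hp', hp'.dvd_of_dvd_pow h, by omega⟩)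
  · exact (Nat.Prime.dvd_factorial hp').mp (hp'.dvd_of_dvd_pow h)

/-- **Pasten 2024, Thm. 6.1 (a) from Prop. 6.13 (with Lemma 6.14 and Lemma 6.18) and Lemma 6.8** —
the whole printed proof of part (a) (§6.9 p. 25) performed in the tree: the two-prime step from
`h613a` (Ribet–Takahashi's identity with `i_p ∣ κ₁(S)` and `j_r ≤ r`, for `E` semi-stable away from
`S`) and `h68` (Mazur–Kenku) (`eqSequentially_a_of_prop_6_13_general_of_lemma_6_8`), then the
telescoping with `rᵢ < pᵢ` (`PastenShimura2024_thm_6_1_a_of_eqSequentially`, with the `D = 1`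
bridge `h0`, the fact `nonempty_shimuraParametrizationData` and the theorem
`nonempty_shimuraCurveData_holds`); the constant of the fact is `κ_S = κ₁(S)² (163!)²`. What remains
open for `PastenShimura2024_thm_6_1_a_holds` is exactly `h613a` (Prop. 6.13, Lemma 6.14,
Lemma 6.18), `h68` (Lemma 6.8) and `h0`.
[cite: PastenShimura2024, Thm. 6.1 (a) p. 20, proof §6.9 p. 25, Prop. 6.13 and Lemma 6.14 p. 23, Lemma 6.18 p. 25, Lemma 6.8 p. 22] -/
theorem PastenShimura2024_thm_6_1_a_of_prop_6_13_general_of_lemma_6_8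
    (hP : nonempty_shimuraParametrizationData)
    (h0 : ∀ {N : ℕ} [NeZero N] (X : ShimuraCurveData 1 N) (W : WeierstrassCurve ℚ) [W.IsElliptic]
      [W.IsGloballyMinimal], W.conductorNorm ℤ = N →
      ∀ (W₁ : WeierstrassCurve ℚ) [W₁.IsElliptic] (D₁ : ModularParametrizationData W₁ N),
        IsNewformOf W D₁.f →
        (∀ (W₂ : WeierstrassCurve ℚ) [W₂.IsElliptic] (D₂ : ModularParametrizationData W₂ N),
            D₂.f = D₁.f → D₁.modularDegree ≤ D₂.modularDegree) →
      ∀ (W' : WeierstrassCurve ℚ) [W'.IsElliptic] (P : ShimuraParametrizationData X W'),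
        P.IsMinimalFor W → P.deg ∣ D₁.modularDegree)
    (κ₁ : Finset ℕ → ℕ) (hκ₁ : ∀ S, 1 ≤ κ₁ S) (hκ₁' : ∀ S, ∀ p ∈ (κ₁ S).primeFactors, p ≤ 163)
    (h613a : ∀ (S : Finset ℕ) {N D M d p r : ℕ}, p.Prime → r.Prime → p ≠ r → D = d * (p * r) →
      IsAdmissibleFactorization N D M →
      ∀ (X₁ : ShimuraCurveData d (p * r * M)) (X₂ : ShimuraCurveData D M)
        (W : WeierstrassCurve ℚ) [W.IsElliptic] [W.IsGloballyMinimal], W.conductorNorm ℤ = N →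
        (∀ q : ℕ, q.Prime → q ∉ S → ¬ q ^ 2 ∣ N) →
      ∀ (W₁' : WeierstrassCurve ℚ) [W₁'.IsElliptic] (P₁ : ShimuraParametrizationData X₁ W₁'),
        P₁.IsMinimalFor W →
      ∀ (W₂' : WeierstrassCurve ℚ) [W₂'.IsElliptic] (P₂ : ShimuraParametrizationData X₂ W₂'),
        P₂.IsMinimalFor W →
        ∃ i j : ℕ, 0 < i ∧ 0 < j ∧ i ∣ κ₁ S ∧ j ≤ r ∧
          P₁.deg * (i ^ 2 * j ^ 2) = P₂.deg *
            ((W₁'.minimalDiscriminantNorm ℤ).factorization p *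
              (W₂'.minimalDiscriminantNorm ℤ).factorization r))
    (h68 : ∀ (W W' : WeierstrassCurve ℚ) [W.IsElliptic] [W'.IsElliptic], W.IsIsogenous W' →
      ∀ p : ℕ, p.Prime → p ∣ W.conductorNorm ℤ → ¬ p ^ 2 ∣ W.conductorNorm ℤ →
        ∃ a b : ℕ, 0 < a ∧ a ≤ 163 ∧ 0 < b ∧ b ≤ 163 ∧
          (W'.minimalDiscriminantNorm ℤ).factorization p * b =
            a * (W.minimalDiscriminantNorm ℤ).factorization p) :
    PastenShimura2024_thm_6_1_a :=
  PastenShimura2024_thm_6_1_a_of_eqSequentially hP h0 fun S =>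
    ⟨κ₁ S ^ 2 * (Nat.factorial 163) ^ 2, (primeFactors_le_of_kappa_a (hκ₁ S) (hκ₁' S)).1,
      (primeFactors_le_of_kappa_a (hκ₁ S) (hκ₁' S)).2,
      fun hp hr hrp hD hadm X₁ X₂ W _ _ hWN hS W₁' _ P₁ hP₁ W₂' _ P₂ hP₂ =>
        eqSequentially_a_of_prop_6_13_general_of_lemma_6_8 (hκ₁ S) (h613a S) h68 hp hr hrp hD
          hadm X₁ X₂ W hWN hS W₁' P₁ hP₁ W₂' P₂ hP₂⟩

/-! ### The two-prime step of (a) from the Ribet–Takahashi system: Prop. 6.13 with the orders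
`i_p`, `j_p` as functions, Lemma 6.14 and Lemma 6.18 -/

/-- **The two-prime step of Thm. 6.1 (a) from the finer printed inputs** — the (a)-twin of
`twoPrimeStep_of_ribetTakahashi_inputs` (`ShimuraCurveRibetTakahashiCokernelProofs.lean`), over the
same "Ribet–Takahashi system" binders: the orders `i_p(D,M)`, `j_p(D,M)` of the image and cokernel
of `q_{D,M,p,*} : Φ_p(J₀^D(M)) → Φ_p(A_{D,M})` (§6.6 p. 23) as two FUNCTIONS `cI`, `cJ` of the
class-minimal datum and the prime (the tree has no Néron models), with (`h613`) Prop. 6.13 =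
Ribet–Takahashi 1997 Thm. 2 ("`δ_{d,prM}/δ_{dpr,M} = c_p(A_{d,prM}) c_r(A_{dpr,M}) /
(i_p(d,prM)² j_r(dpr,M)²)`"), (`h68`) Lemma 6.8 (Mazur–Kenku), (`h614`) Lemma 6.14 at `S`
("`i_p(D,M)` divides an integer `κ_S`" for `N` squarefree away from `S`, `p ∥ M`) and — the input
specific to item (a) — (`h618`) **Lemma 6.18** (p. 25, Papikian–Rabinoff Cor. 3.5: "`j_p(D,M)`
divides `p − 1` if `p` is odd, and it divides `2` if `p = 2`. In particular, `j_p(D,M) ≤ p`"; only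
the "In particular" is used). Output: literally the hypothesis `hstep` of
`PastenShimura2024_thm_6_1_a_of_eqSequentially` at `S`, with `κ₀ = κ₁² (163!)²`.
[cite: PastenShimura2024, §6.9 p. 25 (item (a)), Prop. 6.13 and Lemma 6.14 p. 23, Lemma 6.18 p. 25, Lemma 6.8 p. 22] -/
theorem twoPrimeStep_a_of_ribetTakahashi_inputs
    (cI cJ : ∀ {D M : ℕ} {X : ShimuraCurveData D M} {W' : WeierstrassCurve ℚ},
      ShimuraParametrizationData X W' → ℕ → ℕ)
    (hI : ∀ {D M : ℕ} {X : ShimuraCurveData D M} {W' : WeierstrassCurve ℚ}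
      (P : ShimuraParametrizationData X W') (p : ℕ), 0 < cI P p)
    (hJ : ∀ {D M : ℕ} {X : ShimuraCurveData D M} {W' : WeierstrassCurve ℚ}
      (P : ShimuraParametrizationData X W') (p : ℕ), 0 < cJ P p)
    (h613 : ∀ {N d M₁ D M p r : ℕ}, p.Prime → r.Prime → p ≠ r → D = d * (p * r) →
      M₁ = p * r * M → IsAdmissibleFactorization N D M →
      ∀ (X₁ : ShimuraCurveData d M₁) (X₂ : ShimuraCurveData D M)
        (W : WeierstrassCurve ℚ) [W.IsElliptic] [W.IsGloballyMinimal], W.conductorNorm ℤ = N →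
      ∀ (W₁' : WeierstrassCurve ℚ) [W₁'.IsElliptic] (P₁ : ShimuraParametrizationData X₁ W₁'),
        P₁.IsMinimalFor W →
      ∀ (W₂' : WeierstrassCurve ℚ) [W₂'.IsElliptic] (P₂ : ShimuraParametrizationData X₂ W₂'),
        P₂.IsMinimalFor W →
        P₁.deg * (cI P₁ p ^ 2 * cJ P₂ r ^ 2) =
          P₂.deg * ((W₁'.minimalDiscriminantNorm ℤ).factorization p *
            (W₂'.minimalDiscriminantNorm ℤ).factorization r))
    (h68 : ∀ (W W' : WeierstrassCurve ℚ) [W.IsElliptic] [W'.IsElliptic], W.IsIsogenous W' →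
      ∀ p : ℕ, p.Prime → p ∣ W.conductorNorm ℤ → ¬ p ^ 2 ∣ W.conductorNorm ℤ →
        ∃ a b : ℕ, 0 < a ∧ a ≤ 163 ∧ 0 < b ∧ b ≤ 163 ∧
          (W'.minimalDiscriminantNorm ℤ).factorization p * b =
            a * (W.minimalDiscriminantNorm ℤ).factorization p)
    {S : Finset ℕ} {κ₁ : ℕ} (hκ₁ : 0 < κ₁)
    (h614 : ∀ {N D M : ℕ}, IsAdmissibleFactorization N D M →
      ∀ (X : ShimuraCurveData D M) (W : WeierstrassCurve ℚ) [W.IsElliptic] [W.IsGloballyMinimal],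
        W.conductorNorm ℤ = N → (∀ q : ℕ, q.Prime → q ∉ S → ¬ q ^ 2 ∣ N) →
      ∀ (W' : WeierstrassCurve ℚ) [W'.IsElliptic] (P : ShimuraParametrizationData X W'),
        P.IsMinimalFor W → ∀ p : ℕ, p.Prime → p ∣ M → ¬ p ^ 2 ∣ M → cI P p ∣ κ₁)
    (h618 : ∀ {N D M : ℕ}, IsAdmissibleFactorization N D M →
      ∀ (X : ShimuraCurveData D M) (W : WeierstrassCurve ℚ) [W.IsElliptic] [W.IsGloballyMinimal],
        W.conductorNorm ℤ = N →
      ∀ (W' : WeierstrassCurve ℚ) [W'.IsElliptic] (P : ShimuraParametrizationData X W'),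
        P.IsMinimalFor W → ∀ p : ℕ, p.Prime → p ∣ D → cJ P p ≤ p)
    {N D M d p r : ℕ} (hp : p.Prime) (hr : r.Prime) (hrp : r < p) (hD : D = d * (p * r))
    (hadm : IsAdmissibleFactorization N D M)
    (X₁ : ShimuraCurveData d (p * r * M)) (X₂ : ShimuraCurveData D M)
    (W : WeierstrassCurve ℚ) [W.IsElliptic] [W.IsGloballyMinimal] (hWN : W.conductorNorm ℤ = N)
    (hS : ∀ q : ℕ, q.Prime → q ∉ S → ¬ q ^ 2 ∣ N)
    (W₁' : WeierstrassCurve ℚ) [W₁'.IsElliptic] (P₁ : ShimuraParametrizationData X₁ W₁')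
    (hP₁ : P₁.IsMinimalFor W)
    (W₂' : WeierstrassCurve ℚ) [W₂'.IsElliptic] (P₂ : ShimuraParametrizationData X₂ W₂')
    (hP₂ : P₂.IsMinimalFor W) :
    ∃ a b : ℕ, 0 < a ∧ 0 < b ∧ b ≤ κ₁ ^ 2 * (Nat.factorial 163) ^ 2 * r ^ 2 ∧
      P₁.deg * b = a * P₂.deg *
        ((W.minimalDiscriminantNorm ℤ).factorization p *
          (W.minimalDiscriminantNorm ℤ).factorization r) := by
  refine eqSequentially_a_of_prop_6_13_general_of_lemma_6_8 (S := S) hκ₁ ?_ h68 hp hr hrp hD hadm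
    X₁ X₂ W hWN hS W₁' P₁ hP₁ W₂' P₂ hP₂
  -- `h613a` from the system: `i = cI P₁ p ∣ κ₁` (Lemma 6.14 at level `(d, prM)`: `p ∥ prM`),
  -- `j = cJ P₂ r ≤ r` (Lemma 6.18 at level `(D, M)`: `r ∣ D`)
  intro N' D' M' d' p' r' hp' hr' hpr' hD' hadm' X₁' X₂' W' _ _ hWN' hS' W₁'' _ P₁' hP₁' W₂'' _ P₂' hP₂'
  have hpD' : p' ∣ D' := ⟨d' * r', by rw [hD']; ring⟩
  have hrD' : r' ∣ D' := ⟨d' * p', by rw [hD']; ring⟩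
  obtain ⟨-, hadm₁', -, -⟩ := hadm'.erase_two_primes hp' hr' hpr' hpD' hrD'
  have hd' : D' / (p' * r') = d' := by
    rw [hD', Nat.mul_div_cancel _ (Nat.mul_pos hp'.pos hr'.pos)]
  rw [hd'] at hadm₁'
  -- `p' ∤ M'` (coprimality of `D'` and `M'`), so `p' ∥ p' r' M'`
  have hpM' : ¬ p' ∣ M' := fun h =>
    hp'.one_lt.ne' ((Nat.Coprime.coprime_dvd_left hpD' hadm'.coprime).eq_one_of_dvd h)
  have hp1 : p' ∣ p' * r' * M' := ⟨r' * M', by ring⟩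
  have hp2 : ¬ p' ^ 2 ∣ p' * r' * M' := by
    intro h2
    have h2' : p' * p' ∣ p' * (r' * M') := by simpa [sq, mul_assoc] using h2
    rcases (Nat.Prime.dvd_mul hp').mp (Nat.dvd_of_mul_dvd_mul_left hp'.pos h2') with h | h
    · exact hpr' ((Nat.prime_dvd_prime_iff_eq hp' hr').mp h)
    · exact hpM' h
  -- the level `(d', p'r'M')` is squarefree away from `S` as well (same `N'`)
  refine ⟨cI P₁' p', cJ P₂' r', hI P₁' p', hJ P₂' r',
    h614 hadm₁' X₁' W' hWN' hS' W₁'' P₁' hP₁' p' hp' hp1 hp2,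
    h618 hadm' X₂' W' hWN' W₂'' P₂' hP₂' r' hr' hrD',
    h613 hp' hr' hpr' hD' rfl hadm' X₁' X₂' W' hWN' W₁'' P₁' hP₁' W₂'' P₂' hP₂'⟩

/-- **Pasten 2024, Thm. 6.1 (a) from the Ribet–Takahashi system, Lemma 6.14 (per `S`), Lemma 6.18,
Lemma 6.8, Jacquet–Langlands and the `D = 1` bridge** — the (a)-twin of
`PastenShimura2024_thm_6_1_b_of_ribetTakahashi_inputs`: `twoPrimeStep_a_of_ribetTakahashi_inputs`
fed into the telescoping `PastenShimura2024_thm_6_1_a_of_eqSequentially`. Compared with item (b),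
NO Diophantine input (Lemmas 6.10–6.12, Thm. 6.17) and no Eisenstein-prime switching (Lemmas
6.15/6.16) is needed: the cokernel orders are bounded prime by prime by Lemma 6.18 and absorbed into
the factor `D` through the ordering `rᵢ < pᵢ`. What remains open for
`PastenShimura2024_thm_6_1_a_holds` is exactly: Prop. 6.13 (Ribet–Takahashi), Lemma 6.14 (Ribet's
Eisenstein property with Lemma 6.7; PROVED from those in `ShimuraCurveRibetTakahashiCokernelProofs`
as `PastenShimura2024_lemma_6_14`), Lemma 6.18 (Papikian–Rabinoff), Lemma 6.8 (Mazur–Kenku, a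
named fact of the tree), the Jacquet–Langlands fact and the `D = 1` bridge.
[cite: PastenShimura2024, Thm. 6.1 (a) p. 20 with its proof §6.9 p. 25] -/
theorem PastenShimura2024_thm_6_1_a_of_ribetTakahashi_inputs
    (cI cJ : ∀ {D M : ℕ} {X : ShimuraCurveData D M} {W' : WeierstrassCurve ℚ},
      ShimuraParametrizationData X W' → ℕ → ℕ)
    (hI : ∀ {D M : ℕ} {X : ShimuraCurveData D M} {W' : WeierstrassCurve ℚ}
      (P : ShimuraParametrizationData X W') (p : ℕ), 0 < cI P p)
    (hJ : ∀ {D M : ℕ} {X : ShimuraCurveData D M} {W' : WeierstrassCurve ℚ}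
      (P : ShimuraParametrizationData X W') (p : ℕ), 0 < cJ P p)
    (h613 : ∀ {N d M₁ D M p r : ℕ}, p.Prime → r.Prime → p ≠ r → D = d * (p * r) →
      M₁ = p * r * M → IsAdmissibleFactorization N D M →
      ∀ (X₁ : ShimuraCurveData d M₁) (X₂ : ShimuraCurveData D M)
        (W : WeierstrassCurve ℚ) [W.IsElliptic] [W.IsGloballyMinimal], W.conductorNorm ℤ = N →
      ∀ (W₁' : WeierstrassCurve ℚ) [W₁'.IsElliptic] (P₁ : ShimuraParametrizationData X₁ W₁'),
        P₁.IsMinimalFor W →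
      ∀ (W₂' : WeierstrassCurve ℚ) [W₂'.IsElliptic] (P₂ : ShimuraParametrizationData X₂ W₂'),
        P₂.IsMinimalFor W →
        P₁.deg * (cI P₁ p ^ 2 * cJ P₂ r ^ 2) =
          P₂.deg * ((W₁'.minimalDiscriminantNorm ℤ).factorization p *
            (W₂'.minimalDiscriminantNorm ℤ).factorization r))
    (h68 : ∀ (W W' : WeierstrassCurve ℚ) [W.IsElliptic] [W'.IsElliptic], W.IsIsogenous W' →
      ∀ p : ℕ, p.Prime → p ∣ W.conductorNorm ℤ → ¬ p ^ 2 ∣ W.conductorNorm ℤ →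
        ∃ a b : ℕ, 0 < a ∧ a ≤ 163 ∧ 0 < b ∧ b ≤ 163 ∧
          (W'.minimalDiscriminantNorm ℤ).factorization p * b =
            a * (W.minimalDiscriminantNorm ℤ).factorization p)
    (κ₁ : Finset ℕ → ℕ) (hκ₁ : ∀ S, 0 < κ₁ S) (hκ₁' : ∀ S, ∀ q ∈ (κ₁ S).primeFactors, q ≤ 163)
    (h614 : ∀ (S : Finset ℕ) {N D M : ℕ}, IsAdmissibleFactorization N D M →
      ∀ (X : ShimuraCurveData D M) (W : WeierstrassCurve ℚ) [W.IsElliptic] [W.IsGloballyMinimal],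
        W.conductorNorm ℤ = N → (∀ q : ℕ, q.Prime → q ∉ S → ¬ q ^ 2 ∣ N) →
      ∀ (W' : WeierstrassCurve ℚ) [W'.IsElliptic] (P : ShimuraParametrizationData X W'),
        P.IsMinimalFor W → ∀ p : ℕ, p.Prime → p ∣ M → ¬ p ^ 2 ∣ M → cI P p ∣ κ₁ S)
    (h618 : ∀ {N D M : ℕ}, IsAdmissibleFactorization N D M →
      ∀ (X : ShimuraCurveData D M) (W : WeierstrassCurve ℚ) [W.IsElliptic] [W.IsGloballyMinimal],
        W.conductorNorm ℤ = N →
      ∀ (W' : WeierstrassCurve ℚ) [W'.IsElliptic] (P : ShimuraParametrizationData X W'),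
        P.IsMinimalFor W → ∀ p : ℕ, p.Prime → p ∣ D → cJ P p ≤ p)
    (hP : nonempty_shimuraParametrizationData)
    (h0 : ∀ {N : ℕ} [NeZero N] (X : ShimuraCurveData 1 N) (W : WeierstrassCurve ℚ) [W.IsElliptic]
      [W.IsGloballyMinimal], W.conductorNorm ℤ = N →
      ∀ (W₁ : WeierstrassCurve ℚ) [W₁.IsElliptic] (D₁ : ModularParametrizationData W₁ N),
        IsNewformOf W D₁.f →
        (∀ (W₂ : WeierstrassCurve ℚ) [W₂.IsElliptic] (D₂ : ModularParametrizationData W₂ N),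
            D₂.f = D₁.f → D₁.modularDegree ≤ D₂.modularDegree) →
      ∀ (W' : WeierstrassCurve ℚ) [W'.IsElliptic] (P : ShimuraParametrizationData X W'),
        P.IsMinimalFor W → P.deg ∣ D₁.modularDegree) :
    PastenShimura2024_thm_6_1_a :=
  PastenShimura2024_thm_6_1_a_of_eqSequentially hP h0 fun S =>
    ⟨κ₁ S ^ 2 * (Nat.factorial 163) ^ 2, (primeFactors_le_of_kappa_a (hκ₁ S) (hκ₁' S)).1,
      (primeFactors_le_of_kappa_a (hκ₁ S) (hκ₁' S)).2,
      fun hp hr hrp hD hadm X₁ X₂ W _ _ hWN hS W₁' _ P₁ hP₁ W₂' _ P₂ hP₂ =>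
        twoPrimeStep_a_of_ribetTakahashi_inputs cI cJ hI hJ h613 h68 (hκ₁ S) (h614 S) h618 hp hr
          hrp hD hadm X₁ X₂ W hWN hS W₁' P₁ hP₁ W₂' P₂ hP₂⟩

/-! ### Over the tree's facts: Lemma 6.8 from Mazur–Kenku, Lemma 6.14 from the Eisenstein property
and Lemma 6.7, the `D = 1` bridge a theorem -/

/-- **Pasten 2024, Thm. 6.1 (a) from the Ribet–Takahashi system, the Eisenstein property, Lemma 6.7,
Lemma 6.18, Mazur–Kenku and Jacquet–Langlands** — the (a)-twin of
`PastenShimura2024_thm_6_1_b_of_ribetTakahashi_eisenstein_mazurKenku`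
(`ShimuraCurveRibetTakahashiCokernelProofs.lean`), with every input that is a theorem or a named fact
of the tree supplied BY NAME: Lemma 6.8 (`h68`) from the named fact
`Literature.NumberTheory.EllipticCurves.mazurKenku_exists_cyclic_isogeny`
(`PastenShimura2024_lemma_6_8_of_mazurKenku'`, `lemma_6_8_factorization_form`); Lemma 6.14 (`h614`,
per `S`) from Ribet's Eisenstein property of `Φ_p(J₀^D(M))` (`hEis`: "`i_p(J₀^D(M), χ_{D,M})`
divides `r + 1 − a_r(A_{D,M})` for every prime `r ∤ N`", proof of Lemma 6.14 p. 23) and Lemma 6.7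
p. 22 (`h67`: Mazur, Ribet, Faltings, Chebotarev) by the tree's `PastenShimura2024_lemma_6_14`; the
`D = 1` bridge by the tree's `ShimuraParametrizationData.IsMinimalFor.deg_dvd_modularDegree`
(`δ^{Sh}_{1,N} = δ_{1,N}`, §2 p. 12). What remains open for `PastenShimura2024_thm_6_1_a_holds` is
then exactly the EXTERNAL theorems the printed proof of item (a) quotes, each in the shape in which
it is invoked, over a vocabulary the tree does not have (Néron models, the component groups `Φ_p`
of `J₀^D(M)` and of `q_{D,M}`): Prop. 6.13 (`h613`, Ribet–Takahashi 1997 Thm. 2), the Eisenstein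
property (`hEis`, Ribet), Lemma 6.7 (`h67`), Lemma 6.18 (`h618`, Papikian–Rabinoff Cor. 3.5:
`j_p(D,M) ≤ p`), plus the named facts `mazurKenku_exists_cyclic_isogeny` and
`nonempty_shimuraParametrizationData`. [cite: PastenShimura2024, Thm. 6.1 (a) p. 20, proof §6.9 p. 25, Lemma 6.7 and Lemma 6.8 p. 22, Prop. 6.13 and Lemma 6.14 p. 23, Lemma 6.18 p. 25, §2 p. 12] -/
theorem PastenShimura2024_thm_6_1_a_of_ribetTakahashi_eisenstein_mazurKenku
    (cI cJ : ∀ {D M : ℕ} {X : ShimuraCurveData D M} {W' : WeierstrassCurve ℚ},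
      ShimuraParametrizationData X W' → ℕ → ℕ)
    (hI : ∀ {D M : ℕ} {X : ShimuraCurveData D M} {W' : WeierstrassCurve ℚ}
      (P : ShimuraParametrizationData X W') (p : ℕ), 0 < cI P p)
    (hJ : ∀ {D M : ℕ} {X : ShimuraCurveData D M} {W' : WeierstrassCurve ℚ}
      (P : ShimuraParametrizationData X W') (p : ℕ), 0 < cJ P p)
    (h613 : ∀ {N d M₁ D M p r : ℕ}, p.Prime → r.Prime → p ≠ r → D = d * (p * r) →
      M₁ = p * r * M → IsAdmissibleFactorization N D M →
      ∀ (X₁ : ShimuraCurveData d M₁) (X₂ : ShimuraCurveData D M)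
        (W : WeierstrassCurve ℚ) [W.IsElliptic] [W.IsGloballyMinimal], W.conductorNorm ℤ = N →
      ∀ (W₁' : WeierstrassCurve ℚ) [W₁'.IsElliptic] (P₁ : ShimuraParametrizationData X₁ W₁'),
        P₁.IsMinimalFor W →
      ∀ (W₂' : WeierstrassCurve ℚ) [W₂'.IsElliptic] (P₂ : ShimuraParametrizationData X₂ W₂'),
        P₂.IsMinimalFor W →
        P₁.deg * (cI P₁ p ^ 2 * cJ P₂ r ^ 2) =
          P₂.deg * ((W₁'.minimalDiscriminantNorm ℤ).factorization p *
            (W₂'.minimalDiscriminantNorm ℤ).factorization r))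
    (hMK : Literature.NumberTheory.EllipticCurves.mazurKenku_exists_cyclic_isogeny)
    (hEis : ∀ {N D M : ℕ}, IsAdmissibleFactorization N D M →
      ∀ (X : ShimuraCurveData D M) (W : WeierstrassCurve ℚ) [W.IsElliptic] [W.IsGloballyMinimal],
        W.conductorNorm ℤ = N →
      ∀ (W' : WeierstrassCurve ℚ) [W'.IsElliptic] (P : ShimuraParametrizationData X W'),
        P.IsMinimalFor W → ∀ p : ℕ, p.Prime → p ∣ M → ¬ p ^ 2 ∣ M →
        ∀ r : ℕ, r.Prime → ¬ r ∣ N → (cI P p : ℤ) ∣ (r + 1 : ℤ) - W'.LFunction r)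
    (h67 : ∀ (S : Finset ℕ) (ℓ : ℕ), ℓ.Prime → ∃ β : ℕ, (163 < ℓ → β = 1) ∧
      ∀ (A : WeierstrassCurve ℚ) [A.IsElliptic],
        (∀ q : ℕ, q.Prime → q ∉ S → ¬ q ^ 2 ∣ A.conductorNorm ℤ) →
        ∀ r₀ : ℕ, ∃ r : ℕ, r₀ < r ∧ r.Prime ∧ ¬ ((ℓ ^ β : ℕ) : ℤ) ∣ (r + 1 : ℤ) - A.LFunction r)
    (h618 : ∀ {N D M : ℕ}, IsAdmissibleFactorization N D M →
      ∀ (X : ShimuraCurveData D M) (W : WeierstrassCurve ℚ) [W.IsElliptic] [W.IsGloballyMinimal],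
        W.conductorNorm ℤ = N →
      ∀ (W' : WeierstrassCurve ℚ) [W'.IsElliptic] (P : ShimuraParametrizationData X W'),
        P.IsMinimalFor W → ∀ p : ℕ, p.Prime → p ∣ D → cJ P p ≤ p)
    (hP : nonempty_shimuraParametrizationData) :
    PastenShimura2024_thm_6_1_a := by
  have h68 := lemma_6_8_factorization_form
    (Literature.NumberTheory.EllipticCurves.ModularForms.PastenShimura2024_lemma_6_8_of_mazurKenku' hMK)
  refine PastenShimura2024_thm_6_1_a_of_eqSequentially hP
    (fun X W _ _ hWN W₁ _ D₁ hf hmin W' _ P hPm => hPm.deg_dvd_modularDegree D₁ hf hmin) fun S => ?_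
  obtain ⟨κ₁, hκ₁, hκ₁', h614⟩ := PastenShimura2024_lemma_6_14 cI hI hEis (h67 S)
  exact ⟨κ₁ ^ 2 * (Nat.factorial 163) ^ 2, (primeFactors_le_of_kappa_a hκ₁ hκ₁').1,
    (primeFactors_le_of_kappa_a hκ₁ hκ₁').2,
    fun hp hr hrp hD hadm X₁ X₂ W _ _ hWN hS W₁' _ P₁ hP₁ W₂' _ P₂ hP₂ =>
      twoPrimeStep_a_of_ribetTakahashi_inputs cI cJ hI hJ h613 h68 hκ₁ h614 h618 hp hr hrp hD hadm
        X₁ X₂ W hWN hS W₁' P₁ hP₁ W₂' P₂ hP₂⟩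

end Literature.NumberTheory.Automorphic

end
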